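import Literature.Analysis.ValidatedNumerics.MatrixEigenEnclosure
import Literature.Analysis.ValidatedNumerics.IntervalMatrixPositiveDefiniteness
import HarnessLib

/-!
# Two-sided enclosure of the least eigenvalue; indefiniteness from a Rayleigh ceiling

Topic `Literature/Computation/Certificates` (cell certnum, layer L1; the `enclosure` block of the
streamed / sparse PSD certificates of `cap.ila.psd` 0.5.1, reader steps C1–C3 of
`pub/certnum/ila/FORMAT-psd-stream.md` v0.2 (2) / v0.3).

A `psd-chol-residual/1` certificate (FLOOR side) concludes `(A - f • 1).PosSemidef` for the
exact symmetric matrix `A` it names (`DyadicCholResidualWitness.posSemidef_sub_smul_one`; kernel lane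
`DyadicCholResidualKernel.posSemidef_of_checkCert`).  A `psd-rayleigh-ceiling/1` record (CEILING
side) is the Rayleigh quotient `μ` of an integer test vector, kernel-checked by
`MatrixEigenEnclosure.checkUpper` ⇒ `∃ i, λᵢ(A) ≤ μ`
(`MatrixEigenEnclosure.exists_eigenvalues_le_of_checkUpper`).  This file names what a reader
concludes from the PAIR, in Mathlib's `Matrix.IsHermitian.eigenvalues` vocabulary:

* `le_eigenvalues_of_posSemidef_sub_smul_one` — the floor in eigenvalue form: `f ≤ λᵢ` for all `i`;
* `not_posSemidef_of_exists_eigenvalues_le_neg`, `not_posSemidef_of_checkUpper` — a NEGATIVE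
  ceiling decides indefiniteness: `μ < 0 ⇒ ¬ A.PosSemidef` (the certificate field
  `indefinite_by_ceiling`; a negative FLOOR never decides anything);
* `floor_le_ceiling` — consistency: a valid floor and a valid ceiling of the same matrix satisfy
  `f ≤ μ` (so a reader that finds `floor > ceiling` has refuted one of the two documents);
* `enclosure_of_posSemidef_sub_smul_one_of_checkUpper` — both sides at once from the kernel data.

References: R. A. Horn, C. R. Johnson, *Matrix Analysis* (2nd ed. 2013), Thm. 4.2.2
(Rayleigh–Ritz); S. M. Rump, *Verification methods*, Acta Numerica 19 (2010) §10.8. [folklore]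
-/

noncomputable section

open Matrix Finset

namespace Literature.Computation.Certificates.LeastEigenvalueEnclosure

open Literature.Analysis.ValidatedNumerics

variable {m : Type*} [Fintype m]

/-- Over `ℝ` the `RCLike` form `re (v⋆ A v)` is the plain quadratic form `v ⬝ᵥ A v`. [folklore] -/
private theorem re_star_form_real (A : Matrix m m ℝ) (v : m → ℝ) :
    RCLike.re (star v ⬝ᵥ (A *ᵥ v)) = v ⬝ᵥ (A *ᵥ v) := by
  rw [star_trivial, RCLike.re_to_real]

/-- Over `ℝ`, `Σ ‖v i‖² = v ⬝ᵥ v`. [folklore] -/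
private theorem sum_normSq_real (v : m → ℝ) : ∑ i, ‖v i‖ ^ 2 = v ⬝ᵥ v := by
  simp only [Real.norm_eq_abs, sq_abs, dotProduct]
  exact Finset.sum_congr rfl fun i _ ↦ sq (v i)

variable [DecidableEq m]

/-- **The floor in eigenvalue form.** If `A - f·1` is positive semidefinite then every eigenvalue of
the symmetric matrix `A` is `≥ f` — the conclusion a reader draws from a replayed
`psd-chol-residual/1` certificate with floor `f` (Rayleigh–Ritz: `λ_min(A) = min_{x ≠ 0} xᵀAx/xᵀx`).
[cite: HornJohnson2013, Thm. 4.2.2] -/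
theorem le_eigenvalues_of_posSemidef_sub_smul_one {A : Matrix m m ℝ} (hA : A.IsHermitian) {f : ℝ}
    (h : (A - f • (1 : Matrix m m ℝ)).PosSemidef) (i : m) : f ≤ hA.eigenvalues i := by
  refine le_eigenvalues_of_forall_re_form hA (fun v ↦ ?_) i
  have h2 := h.dotProduct_mulVec_nonneg v
  rw [star_trivial, sub_mulVec, dotProduct_sub, smul_mulVec, one_mulVec, dotProduct_smul,
    smul_eq_mul] at h2
  rw [re_star_form_real, sum_normSq_real]
  linarith

/-- **A ceiling below zero decides indefiniteness.** If some eigenvalue of the symmetric `A` is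
`≤ μ < 0` then `A` is not positive semidefinite (`A ⪰ 0 ⇔ λ_min(A) ≥ 0`).
[cite: HornJohnson2013, Thm. 4.2.2] -/
theorem not_posSemidef_of_exists_eigenvalues_le_neg {A : Matrix m m ℝ} (hA : A.IsHermitian) {μ : ℝ}
    (h : ∃ i, hA.eigenvalues i ≤ μ) (hμ : μ < 0) : ¬ A.PosSemidef := by
  intro hP
  obtain ⟨i, hi⟩ := h
  have h0 : (0 : ℝ) ≤ hA.eigenvalues i := by
    have h1 : (A - (0 : ℝ) • (1 : Matrix m m ℝ)).PosSemidef := by simpa using hP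
    exact le_eigenvalues_of_posSemidef_sub_smul_one hA h1 i
  linarith

/-- **Consistency of a floor/ceiling pair.** A valid floor `f` (`A - f·1 ⪰ 0`) and a valid
ceiling `μ` (`∃ i, λᵢ ≤ μ`) of the SAME symmetric matrix satisfy `f ≤ μ`; a reader that finds
`floor > ceiling` has therefore refuted one of the two documents.
[cite: HornJohnson2013, Thm. 4.2.2] -/
theorem floor_le_ceiling {A : Matrix m m ℝ} (hA : A.IsHermitian) {f μ : ℝ}
    (hf : (A - f • (1 : Matrix m m ℝ)).PosSemidef) (hμ : ∃ i, hA.eigenvalues i ≤ μ) : f ≤ μ := by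
  obtain ⟨i, hi⟩ := hμ
  exact le_trans (le_eigenvalues_of_posSemidef_sub_smul_one hA hf i) hi

variable {n : ℕ}

/-- **Indefiniteness from a kernel-checked Rayleigh ceiling** (`indefinite_by_ceiling` of the
`cap.ila.psd` 0.5.1 `enclosure` block): if `checkUpper n C Δ u μ` passes with `μ < 0` then NO
symmetric matrix of the entrywise ball `|A i j - C i j| ≤ Δ i j` is positive semidefinite (Rayleigh quotient
bound `λ_min ≤ xᵀAx/xᵀx` instantiated with the certified integer test vector).
[cite: HornJohnson2013, Thm. 4.2.2] -/
theorem not_posSemidef_of_checkUpper {C Δ : List (List ℚ)} {u : List ℚ} {μ : ℚ}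
    (h : checkUpper n C Δ u μ = true) (hμ : μ < 0) {A : Matrix (Fin n) (Fin n) ℝ}
    (hA : A.IsHermitian) (hΔ : ∀ i j : Fin n, |A i j - mreal C i j| ≤ mreal Δ i j) :
    ¬ A.PosSemidef :=
  not_posSemidef_of_exists_eigenvalues_le_neg hA (exists_eigenvalues_le_of_checkUpper h hA hΔ)
    (by exact_mod_cast hμ)

/-- **Two-sided enclosure of the least eigenvalue** (the `enclosure` block: a replayed floor
certificate giving `A - f·1 ⪰ 0` plus a kernel-checked ceiling `checkUpper n C Δ u μ` on a ball
containing `A`): `f ≤ λᵢ(A)` for every `i`, `λᵢ(A) ≤ μ` for some `i`, hence `f ≤ λ_min(A) ≤ μ`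
and `f ≤ μ` (Rayleigh–Ritz both ways). [cite: HornJohnson2013, Thm. 4.2.2] -/
theorem enclosure_of_posSemidef_sub_smul_one_of_checkUpper {C Δ : List (List ℚ)} {u : List ℚ}
    {μ : ℚ} (h : checkUpper n C Δ u μ = true) {A : Matrix (Fin n) (Fin n) ℝ} (hA : A.IsHermitian)
    (hΔ : ∀ i j : Fin n, |A i j - mreal C i j| ≤ mreal Δ i j) {f : ℝ}
    (hf : (A - f • (1 : Matrix (Fin n) (Fin n) ℝ)).PosSemidef) :
    (∀ i, f ≤ hA.eigenvalues i) ∧ (∃ i, hA.eigenvalues i ≤ (μ : ℝ)) ∧ f ≤ (μ : ℝ) :=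
  ⟨le_eigenvalues_of_posSemidef_sub_smul_one hA hf, exists_eigenvalues_le_of_checkUpper h hA hΔ,
    floor_le_ceiling hA hf (exists_eigenvalues_le_of_checkUpper h hA hΔ)⟩

/-! ### The record form of a `psd-rayleigh-ceiling/1` document and the two ball-penalty rules

A `psd-rayleigh-ceiling/1` record (all three members of `cap.ila.psd`: dense `api.rayleigh_ceiling`,
sparse `sparse.rayleigh_ceiling_sparse`, streamed `stream.rayleigh_ceiling_streamed`) carries the
exact integers `vMv = vᵀ·Mnum·v`, `vv = vᵀv`, a `ball_penalty_bound` and the field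
`ceiling = (vMv + ball_penalty_bound) / (den·vv)`; the matrix of record is `C = Mnum/den` (exact
sources) or the entrywise ball `|A − C| ≤ Δ = Rad/den` (ball sources).  A reader's steps C1–C3
(`pub/certnum/ila/FORMAT-psd-stream.md` v0.2 (2), v0.4 (1)) recompute `vMv`, `vv` and a penalty
bound and then conclude `λ_min(A) ≤ ceiling` for EVERY symmetric member `A`.  The statements below
are exactly that conclusion at the `Matrix` level, for ANY penalty bound `P ≥ |x|ᵀΔ|x|`
(`exists_eigenvalues_le_div_of_penalty_le`; v0.4 (1): «any upper bound ≥ the true penalty keeps the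
ceiling valid»), and the two rules producers use for `P`: the EXACT rule `P = |x|ᵀΔ|x|` (dense and
sparse members; Rohn (3.3) upper half = `IntervalPosDef.form_le_mid_add_rad`) and the ROW-SUM rule
`P = max|x|·Σᵢ|xᵢ|·Σⱼ Δᵢⱼ` of the streamed member, whose source carries only the radius row sums
(`abs_dotProduct_mulVec_abs_le_mul_sum_rowsum`).  A negative record ceiling refutes positive
semidefiniteness of every member (`not_posSemidef_of_form_add_penalty_neg`). -/

omit [DecidableEq m] in
/-- **Row-sum rule for the ball penalty.** For an entrywise nonnegative radius matrix `Δ` and a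
vector `x` with `|xᵢ| ≤ B` for all `i`: `|x|ᵀΔ|x| ≤ B · Σᵢ |xᵢ| · Σⱼ Δᵢⱼ` — the over-estimate
`max|v|·Σᵢ|vᵢ|·radrowsumᵢ` recorded as `ball_penalty_bound` by the STREAMED producer
(`stream.exact_quadratic_form`), whose matrix source carries only the radius row sums.
[cite: HornJohnson2013, Thm. 4.2.2] [folklore] -/
theorem abs_dotProduct_mulVec_abs_le_mul_sum_rowsum {Δ : Matrix m m ℝ} (hΔ : ∀ i j, 0 ≤ Δ i j)
    {x : m → ℝ} {B : ℝ} (hB : ∀ i, |x i| ≤ B) :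
    |x| ⬝ᵥ Δ *ᵥ |x| ≤ B * ∑ i, |x i| * ∑ j, Δ i j := by
  have h1 : |x| ⬝ᵥ Δ *ᵥ |x| = ∑ i, |x i| * ∑ j, Δ i j * |x j| := by
    simp only [dotProduct, mulVec, Pi.abs_apply]
  rw [h1, Finset.mul_sum]
  refine Finset.sum_le_sum fun i _ ↦ ?_
  have h2 : ∑ j, Δ i j * |x j| ≤ ∑ j, Δ i j * B :=
    Finset.sum_le_sum fun j _ ↦ mul_le_mul_of_nonneg_left (hB j) (hΔ i j)
  have h3 : ∑ j, Δ i j * B = B * ∑ j, Δ i j := by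
    rw [Finset.mul_sum]
    exact Finset.sum_congr rfl fun j _ ↦ mul_comm _ _
  calc |x i| * ∑ j, Δ i j * |x j| ≤ |x i| * (B * ∑ j, Δ i j) := by
        rw [← h3]
        exact mul_le_mul_of_nonneg_left h2 (abs_nonneg _)
    _ = B * (|x i| * ∑ j, Δ i j) := by ring

/-- **The record form of a Rayleigh ceiling (reader steps C1–C3).** If the symmetric `A` lies in
the entrywise ball `|A − C| ≤ Δ`, `x ≠ 0`, `P` is ANY upper bound of the ball penalty `|x|ᵀΔ|x|`,
and `xᵀCx + P ≤ μ·xᵀx`, then some eigenvalue of `A` is `≤ μ` (Rayleigh: `λ_min(A) ≤ xᵀAx/xᵀx`,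
and `xᵀAx ≤ xᵀCx + |x|ᵀΔ|x|` on the ball — Rohn (3.3), upper half).
[cite: HornJohnson2013, Thm. 4.2.2] -/
theorem exists_eigenvalues_le_of_form_add_penalty_le {A C Δ : Matrix m m ℝ} (hA : A.IsHermitian)
    (hΔ : ∀ i j, |A i j - C i j| ≤ Δ i j) {x : m → ℝ} (hx : 0 < x ⬝ᵥ x) {P μ : ℝ}
    (hP : |x| ⬝ᵥ Δ *ᵥ |x| ≤ P) (hμ : x ⬝ᵥ C *ᵥ x + P ≤ μ * (x ⬝ᵥ x)) :
    ∃ i, hA.eigenvalues i ≤ μ := by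
  refine exists_eigenvalues_le_of_re_form_le hA (v := x) ?_ ?_
  · rwa [sum_normSq_real]
  · rw [re_star_form_real, sum_normSq_real]
    have h1 := IntervalPosDef.form_le_mid_add_rad hΔ x
    linarith

/-- **The certificate's `ceiling` field bounds `λ_min` for every member**: with the hypotheses of
`exists_eigenvalues_le_of_form_add_penalty_le`, some eigenvalue of `A` is
`≤ (xᵀCx + P) / xᵀx` — the document's `ceiling = (vMv + ball_penalty_bound)/(den·vv)` read with
`C = Mnum/den`, `Δ = Rad/den`, `x = v`. [cite: HornJohnson2013, Thm. 4.2.2] -/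
theorem exists_eigenvalues_le_div_of_penalty_le {A C Δ : Matrix m m ℝ} (hA : A.IsHermitian)
    (hΔ : ∀ i j, |A i j - C i j| ≤ Δ i j) {x : m → ℝ} (hx : 0 < x ⬝ᵥ x) {P : ℝ}
    (hP : |x| ⬝ᵥ Δ *ᵥ |x| ≤ P) :
    ∃ i, hA.eigenvalues i ≤ (x ⬝ᵥ C *ᵥ x + P) / (x ⬝ᵥ x) :=
  exists_eigenvalues_le_of_form_add_penalty_le hA hΔ hx hP (by rw [div_mul_cancel₀ _ hx.ne'])

/-- **EXACT rule** (dense and sparse producers; streamed producer for sources that hold `Rad`):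
`P = |x|ᵀΔ|x|` itself ⇒ `λᵢ(A) ≤ (xᵀCx + |x|ᵀΔ|x|)/xᵀx` for some `i`.
[cite: HornJohnson2013, Thm. 4.2.2] -/
theorem exists_eigenvalues_le_div_of_exact_rule {A C Δ : Matrix m m ℝ} (hA : A.IsHermitian)
    (hΔ : ∀ i j, |A i j - C i j| ≤ Δ i j) {x : m → ℝ} (hx : 0 < x ⬝ᵥ x) :
    ∃ i, hA.eigenvalues i ≤ (x ⬝ᵥ C *ᵥ x + |x| ⬝ᵥ Δ *ᵥ |x|) / (x ⬝ᵥ x) :=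
  exists_eigenvalues_le_div_of_penalty_le hA hΔ hx le_rfl

/-- **ROW-SUM rule** (streamed producer `stream.rayleigh_ceiling_streamed`, whose source carries
only `radrowsumᵢ = Σⱼ Radᵢⱼ`): with `|xᵢ| ≤ B`,
`λᵢ(A) ≤ (xᵀCx + B·Σᵢ|xᵢ|·Σⱼ Δᵢⱼ)/xᵀx` for some `i` and every symmetric member `A` of the ball.
[cite: HornJohnson2013, Thm. 4.2.2] -/
theorem exists_eigenvalues_le_div_of_rowsum_rule {A C Δ : Matrix m m ℝ} (hA : A.IsHermitian)
    (hΔ : ∀ i j, |A i j - C i j| ≤ Δ i j) {x : m → ℝ} (hx : 0 < x ⬝ᵥ x) {B : ℝ}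
    (hB : ∀ i, |x i| ≤ B) :
    ∃ i, hA.eigenvalues i ≤ (x ⬝ᵥ C *ᵥ x + B * ∑ i, |x i| * ∑ j, Δ i j) / (x ⬝ᵥ x) :=
  exists_eigenvalues_le_div_of_penalty_le hA hΔ hx
    (abs_dotProduct_mulVec_abs_le_mul_sum_rowsum (fun i j ↦ (abs_nonneg _).trans (hΔ i j)) hB)

/-- **Exact sources** (`ball_penalty_bound = 0`): for the matrix `A` itself and any `x ≠ 0`,
`λᵢ(A) ≤ xᵀAx/xᵀx` for some `i` (the plain Rayleigh quotient of the integer test vector).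
[cite: HornJohnson2013, Thm. 4.2.2] -/
theorem exists_eigenvalues_le_div_self {A : Matrix m m ℝ} (hA : A.IsHermitian) {x : m → ℝ}
    (hx : 0 < x ⬝ᵥ x) : ∃ i, hA.eigenvalues i ≤ (x ⬝ᵥ A *ᵥ x) / (x ⬝ᵥ x) := by
  have h := exists_eigenvalues_le_div_of_penalty_le (C := A) (Δ := 0) hA
    (fun i j ↦ by simp) hx (P := 0) (by simp)
  simpa using h

/-- **A negative record ceiling refutes positive semidefiniteness of EVERY member** (the field
`certified_indefinite` / `indefinite_by_ceiling`): if `xᵀCx + P < 0` for some `x ≠ 0` and some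
penalty bound `P ≥ |x|ᵀΔ|x|`, then no matrix of the ball `|A − C| ≤ Δ` is positive semidefinite
(a non-symmetric member is not `PosSemidef` by definition; a symmetric one has an eigenvalue
`≤ (xᵀCx + P)/xᵀx < 0`). [cite: HornJohnson2013, Thm. 4.2.2] -/
theorem not_posSemidef_of_form_add_penalty_neg {A C Δ : Matrix m m ℝ}
    (hΔ : ∀ i j, |A i j - C i j| ≤ Δ i j) {x : m → ℝ} (hx : 0 < x ⬝ᵥ x) {P : ℝ}
    (hP : |x| ⬝ᵥ Δ *ᵥ |x| ≤ P) (hneg : x ⬝ᵥ C *ᵥ x + P < 0) : ¬ A.PosSemidef := fun hPSD ↦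
  not_posSemidef_of_exists_eigenvalues_le_neg hPSD.1
    (exists_eigenvalues_le_div_of_penalty_le hPSD.1 hΔ hx hP) (div_neg_of_neg_of_pos hneg hx) hPSD

/-- **The record arithmetic, integer data.** The literal C3 formula: for integer `Mnum`, `Rad`, a
positive denominator `den`, an integer test vector `v ≠ 0` and ANY integer `bound ≥ |v|ᵀ·Rad·|v|`,
every symmetric `A` with `|A i j − Mnum i j / den| ≤ Rad i j / den` has an eigenvalue
`≤ (vᵀ·Mnum·v + bound) / (den · vᵀv)` — the `ceiling` field of a `psd-rayleigh-ceiling/1` record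
(`vMv`, `ball_penalty_bound`, `vv` being the recorded integers). [cite: HornJohnson2013, Thm. 4.2.2] -/
theorem exists_eigenvalues_le_record_ceiling {A : Matrix m m ℝ} (hA : A.IsHermitian)
    {Mnum Rad : Matrix m m ℤ} {den : ℕ} (hden : 0 < den)
    (hΔ : ∀ i j, |A i j - (Mnum i j : ℝ) / den| ≤ (Rad i j : ℝ) / den) {v : m → ℤ}
    (hv : 0 < v ⬝ᵥ v) {bound : ℤ} (hbound : |v| ⬝ᵥ Rad *ᵥ |v| ≤ bound) :
    ∃ i, hA.eigenvalues i ≤ ((v ⬝ᵥ Mnum *ᵥ v + bound : ℤ) : ℝ) / ((den : ℝ) * ((v ⬝ᵥ v : ℤ) : ℝ)) := by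
  have hd : (0 : ℝ) < den := by exact_mod_cast hden
  set x : m → ℝ := fun i ↦ (v i : ℝ) with hxdef
  set C : Matrix m m ℝ := fun i j ↦ (Mnum i j : ℝ) / den with hCdef
  set Δ : Matrix m m ℝ := fun i j ↦ (Rad i j : ℝ) / den with hΔdef
  have hxx : x ⬝ᵥ x = ((v ⬝ᵥ v : ℤ) : ℝ) := by
    simp only [hxdef, dotProduct, Int.cast_sum, Int.cast_mul]
  have hxC : x ⬝ᵥ C *ᵥ x = ((v ⬝ᵥ Mnum *ᵥ v : ℤ) : ℝ) / den := by
    simp only [hxdef, hCdef, dotProduct, mulVec, Int.cast_sum, Int.cast_mul, Finset.sum_div]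
    refine Finset.sum_congr rfl fun i _ ↦ ?_
    rw [mul_div_assoc, Finset.sum_div]
    refine congrArg _ (Finset.sum_congr rfl fun j _ ↦ ?_)
    ring
  have hxΔ : |x| ⬝ᵥ Δ *ᵥ |x| = ((|v| ⬝ᵥ Rad *ᵥ |v| : ℤ) : ℝ) / den := by
    simp only [hxdef, hΔdef, dotProduct, mulVec, Pi.abs_apply, Int.cast_sum, Int.cast_mul,
      Int.cast_abs, Finset.sum_div]
    refine Finset.sum_congr rfl fun i _ ↦ ?_
    rw [mul_div_assoc, Finset.sum_div]
    refine congrArg _ (Finset.sum_congr rfl fun j _ ↦ ?_)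
    ring
  have hx : 0 < x ⬝ᵥ x := by rw [hxx]; exact_mod_cast hv
  have hP : |x| ⬝ᵥ Δ *ᵥ |x| ≤ (bound : ℝ) / den := by
    rw [hxΔ]
    exact div_le_div_of_nonneg_right (by exact_mod_cast hbound) hd.le
  obtain ⟨i, hi⟩ := exists_eigenvalues_le_div_of_penalty_le (C := C) (Δ := Δ) hA
    (fun i j ↦ by simpa [hCdef, hΔdef] using hΔ i j) hx hP
  refine ⟨i, hi.trans_eq ?_⟩
  rw [hxC, hxx, Int.cast_add, ← add_div, div_div]

end Literature.Computation.Certificates.LeastEigenvalueEnclosure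

end
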